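import Mathlib
import Summits.Ventures.PercRepro2.V1ParallelClosure

/-! # The Hall reading of down-set domination (seat mine-b, cell pub-perc-repro2; MINE-B.md §20.3)

`DownDom r b` says every lower set carries non-negative `ν`-mass, `ν = [r = 1] − b·[r = 0]`.  By
Hall's marriage theorem (Mathlib, `Finset.all_card_le_biUnion_card_iff_exists_injective`) applied
to the sources `{r = 0, b ≥ 1}` replicated `b` times, this gives a **private assignment**: an
injective map from the slots `(x, i < b x)` to `{r = 1}` with `f (x, i) ≤ x` — every configuration
with `r = 0`, `b = a` owns `a` private configurations below it with `r = 1`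
(`exists_private_targets_of_downDom`).  On a pattern cube (order = inclusion of the blue sets) this is
the universal subset Hall (UH) of MINE-B.md §18.1: every `γ` with `F_R = 0`, `F_B = a` owns `a`
private `γ′ ⊆ γ` with `F_R(γ′) = 1`. -/

namespace Summit.Ventures.PercRepro2.UHClosure

open Finset

variable {X : Type*} [Preorder X] [Fintype X] [DecidableEq X] [DecidableRel (α := X) (· ≤ ·)]

/-- The sources of (UH): configurations with `r = 0` and `b ≥ 1`. -/
abbrev SrcD (r b : X → ℕ) := {x : X // r x = 0 ∧ 1 ≤ b x}

/-- A bound on the blue labels, used to index the replicas. -/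
def boundD (b : X → ℕ) : ℕ := univ.sup b + 1

omit [Preorder X] [DecidableEq X] [DecidableRel (α := X) (· ≤ ·)] in
/-- every blue label is below the bound -/
lemma lt_boundD (b : X → ℕ) (x : X) : b x < boundD b :=
  Nat.lt_succ_of_le (Finset.le_sup (mem_univ x))

/-- The slots: a source `x` replicated `b x` times (`i < b x`). -/
abbrev SlotD (r b : X → ℕ) := {p : SrcD r b × Fin (boundD b) // p.2.val < b p.1.1}

/-- The admissible targets of a slot: the configurations below its source with `r = 1`. -/
def targetsD (r b : X → ℕ) (p : SlotD r b) : Finset X :=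
  univ.filter (fun y => y ≤ p.1.1.1 ∧ r y = 1)

/-- the lower closure of the sources of a set of slots -/
def downClosure (r b : X → ℕ) (s : Finset (SlotD r b)) : Finset X :=
  univ.filter (fun y => ∃ p ∈ s, y ≤ p.1.1.1)

omit [DecidableEq X] in
/-- the lower closure is a lower set -/
lemma downClosure_isLowerSet (r b : X → ℕ) (s : Finset (SlotD r b)) :
    IsLowerSet (↑(downClosure r b s) : Set X) := by
  intro y z hzy hy
  simp only [downClosure, coe_filter, mem_univ, true_and, Set.mem_setOf_eq] at hy ⊢
  obtain ⟨p, hp, hle⟩ := hy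
  exact ⟨p, hp, hzy.trans hle⟩

/-- the union of the targets of a set of slots is `{r = 1} ∩ (lower closure)` -/
lemma biUnion_targetsD (r b : X → ℕ) (s : Finset (SlotD r b)) :
    s.biUnion (targetsD r b) = (downClosure r b s).filter (fun y => r y = 1) := by
  ext y
  simp only [mem_biUnion, targetsD, downClosure, mem_filter, mem_univ, true_and]
  constructor
  · rintro ⟨p, hp, hle, hy⟩
    exact ⟨⟨p, hp, hle⟩, hy⟩
  · rintro ⟨⟨p, hp, hle⟩, hy⟩
    exact ⟨p, hp, hle, hy⟩

omit [Preorder X] [DecidableRel (α := X) (· ≤ ·)] in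
/-- the slots of a set over a fixed source are at most `b` of them -/
lemma card_fibreD_le (r b : X → ℕ) (s : Finset (SlotD r b)) (x : SrcD r b) :
    (s.filter (fun p => p.1.1 = x)).card ≤ b x.1 := by
  have h : (s.filter (fun p => p.1.1 = x)).card ≤ (Finset.range (b x.1)).card := by
    apply Finset.card_le_card_of_injOn (fun p => p.1.2.val)
    · intro p hp
      simp only [Finset.mem_coe, mem_filter] at hp
      simp only [Finset.coe_range, Set.mem_Iio]
      rw [← hp.2]; exact p.2
    · intro p hp q hq hpq
      simp only [Finset.mem_coe, mem_filter] at hp hq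
      apply Subtype.ext
      apply Prod.ext
      · rw [hp.2, hq.2]
      · exact Fin.ext hpq
  simpa using h

omit [Preorder X] [DecidableRel (α := X) (· ≤ ·)] in
/-- the number of slots of a set is at most the `b`-weighted number of its sources -/
lemma card_slotsD_le (r b : X → ℕ) (s : Finset (SlotD r b)) :
    (s.card : ℤ) ≤ ∑ x ∈ s.image (fun p => p.1.1), (b x.1 : ℤ) := by
  rw [Finset.card_eq_sum_card_image (fun p => p.1.1) s]
  push_cast
  apply Finset.sum_le_sum
  intro x _
  exact_mod_cast card_fibreD_le r b s x

/-- the source weight of `ν`: `b·[r = 0]` -/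
def wS (r b : X → ℕ) (y : X) : ℤ := if r y = 0 then (b y : ℤ) else 0

/-- the target indicator of `ν`: `[r = 1]` -/
def indR1 (r : X → ℕ) (y : X) : ℤ := if r y = 1 then 1 else 0

omit [Preorder X] [Fintype X] [DecidableEq X] [DecidableRel (α := X) (· ≤ ·)] in
/-- `ν` is the target indicator minus the source weight -/
lemma nu_eq_sub (r b : X → ℕ) (y : X) : nu r b y = indR1 r y - wS r b y := rfl

omit [Preorder X] [Fintype X] [DecidableEq X] [DecidableRel (α := X) (· ≤ ·)] in
/-- the source weight is non-negative -/
lemma wS_nonneg (r b : X → ℕ) (y : X) : 0 ≤ wS r b y := by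
  unfold wS; split_ifs <;> simp

/-- the `b`-weighted sources of a set of slots are part of the source mass of the lower closure -/
lemma sum_sourcesD_le (r b : X → ℕ) (s : Finset (SlotD r b)) :
    ∑ x ∈ s.image (fun p => p.1.1), (b x.1 : ℤ) ≤ ∑ y ∈ downClosure r b s, wS r b y := by
  have h1 : ∑ x ∈ s.image (fun p => p.1.1), (b x.1 : ℤ)
      = ∑ y ∈ (s.image (fun p => p.1.1)).map ⟨Subtype.val, Subtype.val_injective⟩, wS r b y := by
    rw [Finset.sum_map]
    apply Finset.sum_congr rfl
    intro x _
    simp only [Function.Embedding.coeFn_mk, wS, x.2.1, if_true]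
  rw [h1]
  apply Finset.sum_le_sum_of_subset_of_nonneg
  · intro y hy
    simp only [mem_map, mem_image, Function.Embedding.coeFn_mk] at hy
    obtain ⟨x, ⟨p, hp, hpx⟩, rfl⟩ := hy
    simp only [downClosure, mem_filter, mem_univ, true_and]
    exact ⟨p, hp, by rw [hpx]⟩
  · intro y _ _; exact wS_nonneg _ _ _

/-- **Hall's condition from down-set domination**: any set of slots has at least as many admissible
targets as slots. -/
lemma hall_conditionD (r b : X → ℕ) (h : DownDom r b) (s : Finset (SlotD r b)) :
    s.card ≤ (s.biUnion (targetsD r b)).card := by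
  have hD := h (downClosure r b s) (downClosure_isLowerSet r b s)
  have hsplit : ∑ y ∈ downClosure r b s, nu r b y
      = ∑ y ∈ downClosure r b s, indR1 r y - ∑ y ∈ downClosure r b s, wS r b y := by
    rw [← Finset.sum_sub_distrib]
    exact Finset.sum_congr rfl (fun y _ => nu_eq_sub r b y)
  have hT : ∑ y ∈ downClosure r b s, indR1 r y = ((s.biUnion (targetsD r b)).card : ℤ) := by
    rw [biUnion_targetsD, Finset.card_filter]
    push_cast
    apply Finset.sum_congr rfl
    intro y _
    simp only [indR1]
  have h1 := card_slotsD_le r b s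
  have h2 := sum_sourcesD_le r b s
  have : (s.card : ℤ) ≤ ((s.biUnion (targetsD r b)).card : ℤ) := by linarith
  exact_mod_cast this

/-- **The private assignment (UH)**: every source `x` (`r x = 0`, `b x ≥ 1`) owns `b x` private
configurations below it with `r = 1` — an injective map on the slots. -/
theorem exists_private_targets_of_downDom (r b : X → ℕ) (h : DownDom r b) :
    ∃ f : SlotD r b → X, Function.Injective f ∧
      ∀ p : SlotD r b, f p ≤ p.1.1.1 ∧ r (f p) = 1 := by
  obtain ⟨f, hf, hmem⟩ := (Finset.all_card_le_biUnion_card_iff_exists_injective (targetsD r b)).1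
    (hall_conditionD r b h)
  refine ⟨f, hf, fun p => ?_⟩
  have := hmem p
  simp only [targetsD, mem_filter, mem_univ, true_and] at this
  exact this


end Summit.Ventures.PercRepro2.UHClosure
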